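import Mathlib
import Literature.NumberTheory.Transcendental.KirbyEDerivations
import Summits.Schanuel.Schanuel.Theorems.RigidCoreDefs
import Summits.Schanuel.Schanuel.Theorems.RigidCoreSchanuelOnLogFreeCoreRootGerm
import Summits.Schanuel.Schanuel.Theorems.RigidCoreSchanuelOnLogFreeCoreImplicitDeriv

/-!
# Log-free term germs represent the EA-fibres — stub C `stub_termGerm` of line `generic-period-fibre`

Crux `stmt-Schanuel-0970` (`Summit.Schanuel.Schanuel.Theses.RigidCore.SchanuelOnLogFreeCore`),
line `generic-period-fibre`, registered stub `stub_termGerm` (the line's analytic lever; TRUE for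
every parameter `ω`). For the inductive class `IsLogFreeTerm U` of `RigidCoreDefs.lean` on an OPEN
set `U` we prove by structural induction:

* **closure under differentiation** (`IsLogFreeTerm.hasDeriv`): every term has a derivative on `U`
  that is again a term — at root nodes by implicit differentiation (`stub_implicitDeriv`, landed)
  divided by the non-vanishing `∂_Y`;
* the **E-chain rule** (`IsLogFreeTerm.eDerivation_apply`): `D (t z) = deriv t z * D z` for every
  E-derivation `D` of `ℂ` (`Literature.NumberTheory.Transcendental.IsEDerivation`: a `ℤ`-derivation
  with `D (exp a) = exp a * D a`, no continuity) — Leibniz at `+`, `×`, `⁻¹`, the E-rule at `exp`,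
  and at root nodes `D` applied to the root identity compared with its `d/dz`-derivative;
* the **representation theorem** (`exists_term_of_mem_eaFibre`): every element of the fibre
  `F_ω = eaFibre ω` is the value at `ω` of a log-free term defined on a disc around `ω` — the set
  of such values is an intermediate field containing `ω`, closed under `exp`, and relatively
  algebraically closed: a `w` algebraic over it is a simple root of its minimal polynomial
  (separable, characteristic `0`), the coefficients are term values on a common disc, and the
  holomorphic implicit function theorem (`stub_rootGerm`, landed) gives the root germ through `w`.
  This is exactly where log-freeness is used: one parameter and single-valued operations suffice;
* `stub_termGerm` — the registered signature verbatim: the family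
  `𝒯 := {h | h agrees on the disc with a log-free term}` is closed under `deriv` (`deriv` is local),
  its members are differentiable on the disc, fibre-valued (`IsLogFreeTerm.apply_mem_eaFibre`) and
  satisfy the E-chain rule.

Consequences (NoHiddenConstants, the generic-fibre theorem) are in
`RigidCoreSchanuelOnLogFreeCoreGenericFibre.lean`. Sources: idea card `generic-period-fibre`; Kirby,
*Exponential algebraicity in exponential fields*, Bull. LMS 42 (2010) §4 (E-derivations; Lemma 4.6,
the chain rule through polynomial relations); Mathlib (`minpoly`,
`Polynomial.Separable.aeval_derivative_ne_zero`, `PerfectField.ofCharZero`, `Polynomial.hasDerivAt_aeval`).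
-/

noncomputable section

namespace Summit.Schanuel.Schanuel.Theorems.RigidCore

open Complex
open scoped BigOperators Topology

namespace IsLogFreeTerm

variable {U : Set ℂ}

/-! ## Closure under differentiation -/

/-- **The class of log-free terms on an open set is closed under `d/dz`**: every term has a
derivative on `U` which is again a log-free term on `U` (root nodes: implicit differentiation,
`stub_implicitDeriv`, the `∂_Y`-expression being invertible on `U`). -/
theorem hasDeriv (hU : IsOpen U) {t : ℂ → ℂ} (ht : IsLogFreeTerm U t) :
    ∃ t' : ℂ → ℂ, IsLogFreeTerm U t' ∧ ∀ z ∈ U, HasDerivAt t (t' z) z := by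
  induction ht with
  | id => exact ⟨fun _ => (1 : ℂ), IsLogFreeTerm.one, fun z _ => hasDerivAt_id z⟩
  | const q => exact ⟨fun _ => (0 : ℂ), IsLogFreeTerm.zero, fun z _ => hasDerivAt_const z _⟩
  | add _ _ ihf ihg =>
    obtain ⟨f', hf', hf⟩ := ihf
    obtain ⟨g', hg', hg⟩ := ihg
    exact ⟨fun z => f' z + g' z, hf'.add hg', fun z hz => (hf z hz).add (hg z hz)⟩
  | @mul f g hft hgt ihf ihg =>
    obtain ⟨f', hf', hf⟩ := ihf
    obtain ⟨g', hg', hg⟩ := ihg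
    exact ⟨fun z => f' z * g z + f z * g' z, (hf'.mul hgt).add (hft.mul hg'),
      fun z hz => (hf z hz).mul (hg z hz)⟩
  | @inv f hft hne ih =>
    obtain ⟨f', hf', hf⟩ := ih
    refine ⟨fun z => -f' z * ((f z)⁻¹ * (f z)⁻¹), (hf'.neg).mul ((hft.inv hne).mul (hft.inv hne)),
      fun z hz => ?_⟩
    have h := (hf z hz).inv (hne z hz)
    refine h.congr_deriv ?_
    field_simp
  | @exp f hft ih =>
    obtain ⟨f', hf', hf⟩ := ih
    exact ⟨fun z => Complex.exp (f z) * f' z, hft.exp.mul hf', fun z hz => (hf z hz).cexp⟩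
  | @root d a g hat hg hroot hsep ih =>
    choose a' ha' hda using ih
    have hgt : IsLogFreeTerm U g := IsLogFreeTerm.root hat hg hroot hsep
    -- numerator `N = Σ aᵢ' gⁱ` and denominator `∂_Y`
    refine ⟨fun z => -(∑ i : Fin d, a' i z * g z ^ (i : ℕ)) *
        ((d : ℂ) * g z ^ (d - 1) + ∑ i : Fin d, ((i : ℕ) : ℂ) * a i z * g z ^ ((i : ℕ) - 1))⁻¹,
      (IsLogFreeTerm.sum Finset.univ fun i _ => (ha' i).mul (hgt.pow i)).neg.mul
        ((IsLogFreeTerm.rootDeriv hat hgt).inv hsep), fun z hz => ?_⟩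
    have hgd : HasDerivAt g (deriv g z) z :=
      (hg.differentiableAt (hU.mem_nhds hz)).hasDerivAt
    have hev : ∀ᶠ w in nhds z, g w ^ d + ∑ i : Fin d, a i w * g w ^ (i : ℕ) = 0 :=
      Filter.eventually_of_mem (hU.mem_nhds hz) hroot
    have hrel := stub_implicitDeriv d a (fun i => a' i z) g z (deriv g z)
      (fun i => hda i z hz) hgd hev
    have hne := hsep z hz
    convert hgd using 1
    rw [eq_comm, eq_mul_inv_iff_mul_eq₀ hne]
    linear_combination hrel

/-- `deriv`-form of `hasDeriv`. -/
theorem deriv_mem (hU : IsOpen U) {t : ℂ → ℂ} (ht : IsLogFreeTerm U t) :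
    ∃ t' : ℂ → ℂ, IsLogFreeTerm U t' ∧ ∀ z ∈ U, deriv t z = t' z := by
  obtain ⟨t', ht', h⟩ := ht.hasDeriv hU
  exact ⟨t', ht', fun z hz => (h z hz).deriv⟩

end IsLogFreeTerm

/-! ## E-derivations along log-free terms -/

section EDerivation

open Literature.NumberTheory.Transcendental

/-- A `ℤ`-derivation of `ℂ` kills the rationals. -/
theorem derivation_ratCast (D : Derivation ℤ ℂ ℂ) (q : ℚ) : D (q : ℂ) = 0 := by
  have hden : (q.den : ℂ) ≠ 0 := Nat.cast_ne_zero.mpr q.den_ne_zero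
  have h1 : (q.den : ℂ) * (q : ℂ) = (q.num : ℂ) := by
    rw [mul_comm]
    exact_mod_cast Rat.mul_den_eq_num q
  have h2 : D ((q.den : ℂ) * (q : ℂ)) = (q.den : ℂ) * D (q : ℂ) := by
    rw [D.leibniz, D.map_natCast, smul_zero, add_zero, smul_eq_mul]
  rw [h1, D.map_intCast] at h2
  exact (mul_eq_zero.mp h2.symm).resolve_left hden

/-- The E-rule for `Complex.exp`. -/
theorem isEDerivation_apply_cexp {D : Derivation ℤ ℂ ℂ} (hD : IsEDerivation D) (a : ℂ) :
    D (Complex.exp a) = Complex.exp a * D a :=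
  hD a

namespace IsLogFreeTerm

variable {U : Set ℂ}

/-- **E-chain rule along log-free terms**: for every E-derivation `D` of `ℂ` (a derivation with
`D (exp a) = exp a • D a`, no continuity assumed) and every log-free term `t` on an open set `U`,
`D (t z) = t'(z) • D z` at every `z ∈ U`. Leibniz at `+`/`×`/`⁻¹` nodes, the E-rule at `exp`
nodes, and at ROOT nodes `D` applied to the root identity compared with its `d/dz`-derivative
(`stub_implicitDeriv`), dividing by `∂_Y ≠ 0`. -/
theorem eDerivation_apply (hU : IsOpen U) {t : ℂ → ℂ} (ht : IsLogFreeTerm U t) {z : ℂ} (hz : z ∈ U)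
    {D : Derivation ℤ ℂ ℂ} (hD : IsEDerivation D) : D (t z) = deriv t z * D z := by
  induction ht with
  | id => simp
  | const q => simp [derivation_ratCast]
  | @add f g hf hg ihf ihg =>
    rw [map_add, ihf, ihg,
      deriv_fun_add (hf.differentiableAt hU hz) (hg.differentiableAt hU hz)]
    ring
  | @mul f g hf hg ihf ihg =>
    rw [D.leibniz, smul_eq_mul, smul_eq_mul, ihf, ihg,
      deriv_fun_mul (hf.differentiableAt hU hz) (hg.differentiableAt hU hz)]
    ring
  | @inv f hf hne ih =>
    rw [D.leibniz_inv, smul_eq_mul, ih, deriv_fun_inv'' (hf.differentiableAt hU hz) (hne z hz)]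
    field_simp
  | @exp f hf ih =>
    rw [isEDerivation_apply_cexp hD, ih, deriv_cexp (hf.differentiableAt hU hz)]
    ring
  | @root d a g hat hg hroot hsep ih =>
    -- `D` applied to the root identity
    have hid := hroot z hz
    have hDid : D (g z ^ d + ∑ i : Fin d, a i z * g z ^ (i : ℕ)) = 0 := by rw [hid, map_zero]
    rw [map_add, D.leibniz_pow, map_sum] at hDid
    simp only [D.leibniz, D.leibniz_pow, smul_eq_mul, nsmul_eq_mul] at hDid
    -- `d/dz` applied to the root identity
    have hgd : HasDerivAt g (deriv g z) z := (hg.differentiableAt (hU.mem_nhds hz)).hasDerivAt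
    have hev : ∀ᶠ w in nhds z, g w ^ d + ∑ i : Fin d, a i w * g w ^ (i : ℕ) = 0 :=
      Filter.eventually_of_mem (hU.mem_nhds hz) hroot
    have hrel := stub_implicitDeriv d a (fun i => deriv (a i) z) g z (deriv g z)
      (fun i => ((hat i).differentiableAt hU hz).hasDerivAt) hgd hev
    have hne := hsep z hz
    -- rewrite the `D (a i z)` by the induction hypothesis inside the sum
    have hsum : ∑ i : Fin d, (a i z * (((i : ℕ) : ℂ) * (g z ^ ((i : ℕ) - 1) * D (g z))) +
        g z ^ (i : ℕ) * D (a i z)) =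
        (∑ i : Fin d, ((i : ℕ) : ℂ) * a i z * g z ^ ((i : ℕ) - 1)) * D (g z) +
        (∑ i : Fin d, deriv (a i) z * g z ^ (i : ℕ)) * D z := by
      rw [Finset.sum_mul, Finset.sum_mul, ← Finset.sum_add_distrib]
      refine Finset.sum_congr rfl fun i _ => ?_
      rw [ih i]
      ring
    rw [hsum] at hDid
    -- now `∂_Y • D (g z) + N • D z = 0` and `deriv g z • ∂_Y + N = 0`
    apply mul_left_cancel₀ hne
    linear_combination hDid - (D z) * hrel

end IsLogFreeTerm

end EDerivation

/-! ## Term values at a point: an exp-closed, relatively algebraically closed field -/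

section TermValues

open Metric Filter

/-- A finite family of positive reals has a positive lower bound. -/
theorem exists_pos_le_forall {d : ℕ} (ρ : Fin d → ℝ) (hρ : ∀ i, 0 < ρ i) :
    ∃ r : ℝ, 0 < r ∧ ∀ i, r ≤ ρ i := by
  have hev : ∀ᶠ r in 𝓝[>] (0 : ℝ), ∀ i, r ≤ ρ i := by
    refine (eventually_all.mpr fun i => ?_).filter_mono nhdsWithin_le_nhds
    exact eventually_le_nhds (hρ i)
  obtain ⟨r, hr, hr0⟩ := (hev.and self_mem_nhdsWithin).exists
  exact ⟨r, hr0, hr⟩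

/-- The one-variable derivative of the monic polynomial map `Y ↦ Y ^ d + Σ cᵢ Yⁱ`. -/
theorem hasDerivAt_monicSum' (d : ℕ) (c : Fin d → ℂ) (w : ℂ) :
    HasDerivAt (fun Y : ℂ => Y ^ d + ∑ i : Fin d, c i * Y ^ (i : ℕ))
      ((d : ℂ) * w ^ (d - 1) + ∑ i : Fin d, ((i : ℕ) : ℂ) * c i * w ^ ((i : ℕ) - 1)) w := by
  refine (hasDerivAt_pow d w).add ?_
  have h : ∀ i ∈ (Finset.univ : Finset (Fin d)),
      HasDerivAt (fun Y : ℂ => c i * Y ^ (i : ℕ)) (((i : ℕ) : ℂ) * c i * w ^ ((i : ℕ) - 1)) w := by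
    intro i _
    exact ((hasDerivAt_pow (i : ℕ) w).const_mul (c i)).congr_deriv (by ring)
  exact HasDerivAt.fun_sum h

/-- Expansion of a monic polynomial over a subfield, evaluated in `ℂ`, as `Y ^ d + Σ_{i<d} cᵢ Yⁱ`. -/
theorem aeval_eq_monicSum {K : IntermediateField ℚ ℂ} {p : Polynomial K} (hp : p.Monic) (Y : ℂ) :
    Polynomial.aeval Y p = Y ^ p.natDegree +
      ∑ i : Fin p.natDegree, ((p.coeff (i : ℕ) : K) : ℂ) * Y ^ (i : ℕ) := by
  set q : Polynomial ℂ := p.map (algebraMap K ℂ) with hq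
  have hqm : q.Monic := hp.map _
  have hqd : q.natDegree = p.natDegree := hp.natDegree_map _
  have h1 : Polynomial.aeval Y p = q.eval Y := by
    rw [Polynomial.aeval_def, Polynomial.eval_map]
  rw [h1, Polynomial.eval_eq_sum_range, Finset.sum_range_succ, hqd,
    Fin.sum_univ_eq_sum_range (fun i => ((p.coeff i : K) : ℂ) * Y ^ i) p.natDegree]
  have hlead : q.coeff p.natDegree = 1 := by rw [← hqd]; exact hqm.coeff_natDegree
  rw [hlead, one_mul, add_comm]
  congr 1
  refine Finset.sum_congr rfl fun i _ => ?_
  rw [hq, Polynomial.coeff_map, IntermediateField.algebraMap_apply]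

/-- **Representation theorem**: every element of the fibre `F_ω` is the value at `ω` of a log-free
term defined on a disc around `ω`. The set of such values is an intermediate field containing `ω`,
closed under `exp`, and RELATIVELY ALGEBRAICALLY CLOSED — a `w` algebraic over it is a simple root of
its (separable, characteristic `0`) minimal polynomial, whose coefficients are term values on a common
disc, and the holomorphic implicit function theorem (`stub_rootGerm`) provides the root germ
through `w`; hence `F_ω` (an `sInf`) is contained in it. -/
theorem exists_term_of_mem_eaFibre {ω c : ℂ} (hc : c ∈ eaFibre ω) :
    ∃ r : ℝ, 0 < r ∧ ∃ t : ℂ → ℂ, IsLogFreeTerm (ball ω r) t ∧ t ω = c := by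
  -- closure of the set of term values under the field operations and `exp`
  have hadd : ∀ a b : ℂ, (∃ r : ℝ, 0 < r ∧ ∃ t : ℂ → ℂ, IsLogFreeTerm (ball ω r) t ∧ t ω = a) →
      (∃ r : ℝ, 0 < r ∧ ∃ t : ℂ → ℂ, IsLogFreeTerm (ball ω r) t ∧ t ω = b) →
      ∃ r : ℝ, 0 < r ∧ ∃ t : ℂ → ℂ, IsLogFreeTerm (ball ω r) t ∧ t ω = a + b := by
    rintro a b ⟨r₁, hr₁, t₁, ht₁, rfl⟩ ⟨r₂, hr₂, t₂, ht₂, rfl⟩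
    exact ⟨min r₁ r₂, lt_min hr₁ hr₂, fun z => t₁ z + t₂ z,
      (ht₁.mono (ball_subset_ball (min_le_left _ _))).add
        (ht₂.mono (ball_subset_ball (min_le_right _ _))), rfl⟩
  have hmul : ∀ a b : ℂ, (∃ r : ℝ, 0 < r ∧ ∃ t : ℂ → ℂ, IsLogFreeTerm (ball ω r) t ∧ t ω = a) →
      (∃ r : ℝ, 0 < r ∧ ∃ t : ℂ → ℂ, IsLogFreeTerm (ball ω r) t ∧ t ω = b) →
      ∃ r : ℝ, 0 < r ∧ ∃ t : ℂ → ℂ, IsLogFreeTerm (ball ω r) t ∧ t ω = a * b := by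
    rintro a b ⟨r₁, hr₁, t₁, ht₁, rfl⟩ ⟨r₂, hr₂, t₂, ht₂, rfl⟩
    exact ⟨min r₁ r₂, lt_min hr₁ hr₂, fun z => t₁ z * t₂ z,
      (ht₁.mono (ball_subset_ball (min_le_left _ _))).mul
        (ht₂.mono (ball_subset_ball (min_le_right _ _))), rfl⟩
  have hconst : ∀ q : ℚ, ∃ r : ℝ, 0 < r ∧ ∃ t : ℂ → ℂ, IsLogFreeTerm (ball ω r) t ∧ t ω = (q : ℂ) :=
    fun q => ⟨1, one_pos, fun _ => (q : ℂ), IsLogFreeTerm.const q, rfl⟩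
  have hinv : ∀ a : ℂ, (∃ r : ℝ, 0 < r ∧ ∃ t : ℂ → ℂ, IsLogFreeTerm (ball ω r) t ∧ t ω = a) →
      ∃ r : ℝ, 0 < r ∧ ∃ t : ℂ → ℂ, IsLogFreeTerm (ball ω r) t ∧ t ω = a⁻¹ := by
    rintro a ⟨r₁, hr₁, t₁, ht₁, rfl⟩
    by_cases h0 : t₁ ω = 0
    · rw [h0, inv_zero]
      simpa using hconst 0
    · have hne : ∀ᶠ z in 𝓝 ω, t₁ z ≠ 0 :=
        (ht₁.continuousAt isOpen_ball (mem_ball_self hr₁)).eventually_ne h0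
      obtain ⟨r₂, hr₂, hr₂'⟩ := eventually_nhds_iff_ball.mp hne
      exact ⟨min r₁ r₂, lt_min hr₁ hr₂, fun z => (t₁ z)⁻¹,
        (ht₁.mono (ball_subset_ball (min_le_left _ _))).inv
          fun z hz => hr₂' z (ball_subset_ball (min_le_right _ _) hz), rfl⟩
  -- the intermediate field of term values
  let K : IntermediateField ℚ ℂ :=
    { carrier := {a | ∃ r : ℝ, 0 < r ∧ ∃ t : ℂ → ℂ, IsLogFreeTerm (ball ω r) t ∧ t ω = a}
      mul_mem' := fun {a b} ha hb => hmul a b ha hb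
      one_mem' := by simpa using hconst 1
      add_mem' := fun {a b} ha hb => hadd a b ha hb
      zero_mem' := by simpa using hconst 0
      algebraMap_mem' := fun q => by simpa [eq_ratCast] using hconst q
      inv_mem' := fun a ha => hinv a ha }
  have hmemK : ∀ {a : ℂ}, a ∈ K ↔
      ∃ r : ℝ, 0 < r ∧ ∃ t : ℂ → ℂ, IsLogFreeTerm (ball ω r) t ∧ t ω = a := Iff.rfl
  have hωK : ω ∈ K := hmemK.mpr ⟨1, one_pos, fun z => z, IsLogFreeTerm.id, rfl⟩
  have hexpK : ∀ w ∈ K, Complex.exp w ∈ K := by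
    intro w hw
    obtain ⟨r₁, hr₁, t₁, ht₁, rfl⟩ := hmemK.mp hw
    exact hmemK.mpr ⟨r₁, hr₁, fun z => Complex.exp (t₁ z), ht₁.exp, rfl⟩
  -- relative algebraic closedness via the implicit function theorem
  have halgK : ∀ w : ℂ, IsAlgebraic K w → w ∈ K := by
    intro w hw
    set p : Polynomial K := minpoly K w with hp
    have hint : IsIntegral K w := hw.isIntegral
    have hpm : p.Monic := minpoly.monic hint
    have hpw : Polynomial.aeval w p = 0 := minpoly.aeval K w
    have hsep : p.Separable := (minpoly.irreducible hint).separable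
    have hder : Polynomial.aeval w (Polynomial.derivative p) ≠ 0 :=
      hsep.aeval_derivative_ne_zero hpw
    set d := p.natDegree with hd
    -- the coefficients are term values on a common disc
    have hcoef : ∀ i : Fin d, ∃ r : ℝ, 0 < r ∧ ∃ t : ℂ → ℂ, IsLogFreeTerm (ball ω r) t ∧
        t ω = ((p.coeff (i : ℕ) : K) : ℂ) := fun i => hmemK.mp (p.coeff (i : ℕ)).2
    choose ρ hρ a ha haω using hcoef
    obtain ⟨r, hr, hrρ⟩ := exists_pos_le_forall ρ hρ
    have har : ∀ i, IsLogFreeTerm (ball ω r) (a i) := fun i => (ha i).mono (ball_subset_ball (hrρ i))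
    -- `w` is a simple root of `Y ^ d + Σ aᵢ(ω) Yⁱ`
    have hexp : ∀ Y : ℂ, Polynomial.aeval Y p = Y ^ d + ∑ i : Fin d, a i ω * Y ^ (i : ℕ) := by
      intro Y
      rw [aeval_eq_monicSum hpm Y]
      simp only [haω]
      rfl
    have hroot : w ^ d + ∑ i : Fin d, a i ω * w ^ (i : ℕ) = 0 := by rw [← hexp w, hpw]
    have hsimple : (d : ℂ) * w ^ (d - 1) + ∑ i : Fin d, ((i : ℕ) : ℂ) * a i ω * w ^ ((i : ℕ) - 1) ≠ 0 := by
      have h1 : HasDerivAt (fun Y : ℂ => Polynomial.aeval Y p)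
          (Polynomial.aeval w (Polynomial.derivative p)) w := Polynomial.hasDerivAt_aeval p w
      have h2 := hasDerivAt_monicSum' d (fun i => a i ω) w
      have hfun : (fun Y : ℂ => Polynomial.aeval Y p) =
          fun Y : ℂ => Y ^ d + ∑ i : Fin d, a i ω * Y ^ (i : ℕ) := funext hexp
      rw [hfun] at h1
      rw [← h1.unique h2]
      exact hder
    obtain ⟨g, hgω, r', hr', hr'r, hgdiff, hgroot, hgsep⟩ :=
      stub_rootGerm d a ω w r hr (fun i => (har i).differentiableOn) hroot hsimple
    have hgt : IsLogFreeTerm (ball ω r') g :=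
      IsLogFreeTerm.root (fun i => (har i).mono (ball_subset_ball hr'r)) hgdiff hgroot hgsep
    exact hmemK.mpr ⟨r', hr', g, hgt, hgω⟩
  exact hmemK.mp (eaFibre_le hωK hexpK halgK hc)

end TermValues

/-! ## Stub C of line `generic-period-fibre` -/

/-- **Stub C — log-free term germs** (registered stub `stub_termGerm` of crux `stmt-Schanuel-0970`,
line `generic-period-fibre`). Every element `c` of the fibre
`F_ω = sInf {K | ω ∈ K, exp-closed, relatively algebraically closed}` is the value at `ω` of a
member `f` of a family `𝒯` of functions which are complex-differentiable on a disc `ball ω r`,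
which is closed under `deriv`, whose members take values `g z ∈ F_z` at every point `z` of the
disc and satisfy the E-chain rule `D (g z) = g′(z) · D z` there for every E-derivation `D` of `ℂ`.
Proof: `𝒯 := {h | h agrees on the disc with a log-free term}` for the term representing `c`
(`exists_term_of_mem_eaFibre`); closure under `deriv` is `IsLogFreeTerm.hasDeriv` (`deriv` is
local), values and chain rule are `IsLogFreeTerm.apply_mem_eaFibre` and
`IsLogFreeTerm.eDerivation_apply`. -/
theorem stub_termGerm :
    ∀ (ω c : ℂ), c ∈ (sInf {K : IntermediateField ℚ ℂ | ω ∈ K ∧ (∀ w ∈ K, Complex.exp w ∈ K) ∧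
        ∀ w : ℂ, IsAlgebraic K w → w ∈ K} : IntermediateField ℚ ℂ) →
      ∃ r : ℝ, 0 < r ∧ ∃ 𝒯 : Set (ℂ → ℂ), (∃ f ∈ 𝒯, f ω = c) ∧
        ∀ g ∈ 𝒯, DifferentiableOn ℂ g (Metric.ball ω r) ∧ deriv g ∈ 𝒯 ∧
          (∀ z ∈ Metric.ball ω r, g z ∈ (sInf {K : IntermediateField ℚ ℂ | z ∈ K ∧
            (∀ w ∈ K, Complex.exp w ∈ K) ∧ ∀ w : ℂ, IsAlgebraic K w → w ∈ K} : IntermediateField ℚ ℂ)) ∧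
          ∀ z ∈ Metric.ball ω r, ∀ D : Derivation ℤ ℂ ℂ,
            Literature.NumberTheory.Transcendental.IsEDerivation D → D (g z) = deriv g z * D z := by
  intro ω c hc
  obtain ⟨r, hr, t, ht, htω⟩ := exists_term_of_mem_eaFibre (ω := ω) hc
  refine ⟨r, hr, {h | ∃ s : ℂ → ℂ, IsLogFreeTerm (Metric.ball ω r) s ∧ Set.EqOn h s (Metric.ball ω r)},
    ⟨t, ⟨t, ht, fun _ _ => rfl⟩, htω⟩, ?_⟩
  rintro g ⟨s, hs, hgs⟩
  have hopen : IsOpen (Metric.ball ω r) := Metric.isOpen_ball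
  obtain ⟨s', hs', hss'⟩ := hs.hasDeriv hopen
  have hderiv : ∀ z ∈ Metric.ball ω r, deriv g z = s' z := fun z hz =>
    ((hgs.eventuallyEq_of_mem (hopen.mem_nhds hz)).deriv_eq).trans (hss' z hz).deriv
  refine ⟨hs.differentiableOn.congr hgs, ⟨s', hs', hderiv⟩, fun z hz => ?_, fun z hz D hD => ?_⟩
  · rw [hgs hz]
    exact hs.apply_mem_eaFibre hz
  · rw [hgs hz, hderiv z hz, ← (hss' z hz).deriv]
    exact hs.eDerivation_apply hopen hz hD

end Summit.Schanuel.Schanuel.Theorems.RigidCore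

end
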